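import Summits.QuantumFields.YangMills.Theorems.BalabanLadderUVSeamRecCeilingsDefectCollarMoments
import HarnessLib

/-!
# Crux `UVSeamRec` (stmt-QuantumFields-20043), stub `stub_ceilings` (E0′): the TEMPERED-RESPONSE collar — ceilings from
# a kernel law with exterior-dependent tolerance `(C₁/R⁴)(1 + Y(η))` and joint exponential moments of the influence `Y`

Helper file (`--supports stmt-QuantumFields-20043`) of the width-lever seat `ym-20043-ceilings-p2` (lane B of
`stub_ceilings : UV → MomentBounds6 SU(2) rF uRec`, slot v4-F).  HONEST FRAMING: a consumption-side theorem for OPEN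
hypotheses (a tempered-RESPONSE centre law of E0′ type and a β-uniform exponential-moment bound for the influence
functionals of the exterior); nothing of E0′ is claimed; not a gap, not Clay.

WHY (located finding of this seat, note `LANE-B-TEMPERED-RESPONSE-ceilings-p2.md`).  The defect collar (p518354,
`DefectCollar.abs_integral_prod_sub_mean_le_of_defects`; consumed by p519295 and by this seat's p528131/p529130) splits
the exteriors of each cube into GOOD (kernel law at tolerance `C₁/R⁴`) and BAD, bounds the collared factor by its sup
`K = C_A + |p|` on the bad ones, and therefore needs the bad exteriors to be rare AT THE RATE `C₂/R⁴` — for every collar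
radius up to `ℓ₁/a(β)`, i.e. `δ → 0` along `β → ∞` at fixed physical size.  But the response `h(η) = γ_Λ(plane)(η) − ⟨plane⟩`
has, in units `g²/R⁴`, a NON-DEGENERATE limiting law (free field: `−(c′/4)(N² − 1)`, `N` standard normal — the squared
harmonic extension of the exterior), so `μ{R⁴|h| > C₁} → P(|N² − 1| > 4C₁/(c′g²)) > 0`: hypotheses (a) and (b) of the
defect collar cannot both hold with `R`-uniform constants once the continuum limit is non-trivial.  The cure is to let
the tolerance depend on the exterior LINEARLY IN AN INFLUENCE FUNCTIONAL and to ask only β-UNIFORM exponential moments: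

* §1 `abs_integral_prod_sub_mean_le_of_response` — **the tempered-response collar** (any dimension, any torus side): if
  for EVERY exterior `η`, `|γ_{Λᵢ}Aᵢ(η) − p| ≤ ε (1 + Yᵢ(η))` with measurable bounded `Yᵢ ≥ 0`, and the torus state has
  `∫ exp(Σ_{i∈T} Yᵢ∘lift) dμ ≤ exp(B·#T)` for every `T`, then `|⟨∏ᵢ(Aᵢ − ⟨Aᵢ⟩)⟩| ≤ (ε (2 + e^B) e^B)ⁿ`.  No good/bad split,
  no rarity RATE: the `R⁻⁴` sits in the response coefficient `ε = C₁/R⁴`, the size of the exterior in `Y`, and `Y` needs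
  exponential moments with a constant `B` that does not depend on `R` (free field: `Y = c N²`, fine; coherently fluxed
  penetrating exteriors of flux `f` per top block — lead g7's falsifier of `FBL6` — have deviation `≍ f²/R⁴` and
  `Y ≍ f²`: consistent).
* §2 **`momentBounds6_of_temperedResponse`** — the registered all-odd-sides currency `MomentBounds6 G r a` from (a′) the
  TEMPERED-RESPONSE CENTRE LAW `|kerE(plane q x)(η) − p q β| ≤ (C₁/R⁴)(1 + Y β R q x η)` for ALL exteriors and (EM′) the
  joint exponential moment bound `⟨exp(Σ_{i∈T} Y_i∘lift)⟩_{2L+1,β} ≤ exp(B·#T)` for cyclically separated cubes on every odd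
  torus; constant `C = C₁ (2 + e^B) e^B`.  §3 `momentBounds6OnSides_of_temperedResponse` — the class-currency twin (p464599)
  for lane A's station.  The suppliers of (EM′) are this seat's p527372/p529130 (polymer product law:
  `B = λe^{λΛ}W`; scale-factorised (SF)-type moments: `B = c_V λ W`) — with NO `R`-dependence required any more.

References: H.-O. Georgii, *Gibbs Measures and Phase Transitions* (2011) Thm. 4.17 (the DLR step, via p518354's collar
identity); E. Seiler, LNP 159 (1982) Ch. 2; for the free-field calibration: J. Glimm, A. Jaffe, *Quantum Physics* (1987)
§9.1 (Dirichlet covariances / harmonic extension).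
-/

set_option autoImplicit false

noncomputable section

open MeasureTheory Filter Topology Finset
open Literature.Probability.LatticeModels
open Literature.MathematicalPhysics.QuantumFieldTheory (GaugeConfig wilsonMeasure isProbabilityMeasure_wilsonMeasure
  measurable_torusLift LatticeRep)
open Literature.MathematicalPhysics.QuantumLattice
open Summit.QuantumFields.YangMills.Cruxes.UVSeamRec.DefectCollar (integral_prod_sub_mean_eq_integral_prod_collared)

namespace Summit.QuantumFields.YangMills.Cruxes.UVSeamRec.TemperedResponse

/-! ## §1 The tempered-response collar (any dimension, any torus side) -/

section Engine

variable {d N : ℕ} {G : Type*} [Group G] [TopologicalSpace G] [IsTopologicalGroup G]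
  [CompactSpace G] [MeasurableSpace G] [BorelSpace G] [SecondCountableTopology G]
  (ρ : G →* Matrix (Fin N) (Fin N) ℂ)

/-- **THE TEMPERED-RESPONSE COLLAR.**  In the geometry of the collar identity (bounded continuous cylinder observables
`Aᵢ` with supports `Sᵢ`, link sets `Λᵢ` injecting into the torus and far from each other's supports), suppose that for
EVERY exterior `η` the kernel mean obeys `|γ_{Λᵢ}Aᵢ(η) − p| ≤ ε (1 + Yᵢ(η))` with measurable, bounded INFLUENCE
FUNCTIONALS `Yᵢ ≥ 0`, and that the torus state gives their joint exponential moments the multiplicative bound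
`∫ exp(Σ_{i∈T} Yᵢ(lift V)) dμ ≤ exp(B·#T)` for every set `T` of sites.  Then the centred `n`-th moment of the `Aᵢ` is at
most `(ε (2 + e^B) e^B)ⁿ`.  Proof: by the collar identity (p518354) the moment is `∫ ∏ hᵢ(lift V)`,
`hᵢ = γ_{Λᵢ}Aᵢ − ⟨Aᵢ⟩`; `|⟨Aᵢ⟩ − p| ≤ ε (1 + ⟨Yᵢ∘lift⟩) ≤ ε (1 + e^B)`, so `|hᵢ| ≤ ε (2 + e^B)(1 + Yᵢ)`;
`∏ (1 + Yᵢ) ≤ exp(Σ Yᵢ)`; integrate.  Compared with the defect collar (`…_of_defects`: good/bad split, bad factors bounded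
by their sup) no rarity RATE is needed — only β-uniform exponential moments. [folklore: Georgii (2011) Thm. 4.17 for
the DLR part] -/
theorem abs_integral_prod_sub_mean_le_of_response (hρ : Continuous ρ) (β : ℝ) {L : ℕ} [NeZero L] {n : ℕ}
    (Λ S : Fin n → Finset (ZdEdge d))
    (A : Fin n → LGConfig d G → ℝ) (hAc : ∀ i, Continuous (A i)) {CA : ℝ} (hAb : ∀ i U, |A i U| ≤ CA)
    (hAS : ∀ i, IsCylinder (A i) (S i))
    (hinj : ∀ i, Set.InjOn (Torus.proj L)
      ((Λ i ∪ S i ∪ (plaquettesTouching (Λ i)).biUnion plaquetteEdges).image Prod.fst : Set (Site d)))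
    (hfar : ∀ i j, i ≠ j → ∀ e ∈ S j ∪ (plaquettesTouching (Λ j)).biUnion plaquetteEdges, ∀ e' ∈ Λ i,
      torusEdge L e ≠ torusEdge L e')
    (m : Fin n → ℝ) (hm : ∀ i, m i = ∫ W, A i (torusLift L W) ∂(wilsonMeasure ρ β))
    (Y : Fin n → LGConfig d G → ℝ) (hYm : ∀ i, Measurable (Y i)) (hY0 : ∀ i η, 0 ≤ Y i η)
    {MY : ℝ} (hYb : ∀ i η, Y i η ≤ MY)
    {p ε B : ℝ} (hε : 0 ≤ ε)
    (hker : ∀ i η, |(∫ U, A i U ∂(ymSpecification ρ β (Λ i) η)) - p| ≤ ε * (1 + Y i η))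
    (hmom : ∀ T : Finset (Fin n),
      ∫ V, Real.exp (∑ i ∈ T, Y i (torusLift L V)) ∂(wilsonMeasure ρ β) ≤ Real.exp (B * T.card)) :
    |∫ V, ∏ i, (A i (torusLift L V) - m i) ∂(wilsonMeasure ρ β)| ≤
      (ε * ((2 + Real.exp B) * Real.exp B)) ^ n := by
  classical
  haveI := isProbabilityMeasure_wilsonMeasure (d := d) (L := L) ρ hρ β
  rw [integral_prod_sub_mean_eq_integral_prod_collared ρ hρ β Λ S A hAc hAb hAS hinj hfar m]
  -- kernel means
  set g : Fin n → LGConfig d G → ℝ := fun i η => ∫ U, A i U ∂(ymSpecification ρ β (Λ i) η) with hgdef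
  have hgc : ∀ i, Continuous (g i) := fun i =>
    continuous_integral_ymSpecification ρ hρ β (Λ i) (hAc i) (hAb i)
  have hgb : ∀ i η, |g i η| ≤ CA := fun i η => abs_integral_ymSpecification_le ρ hρ β (Λ i) (hAb i) η
  have hgm : ∀ i, Measurable fun V : GaugeConfig d L G => g i (torusLift L V) := fun i =>
    ((hgc i).comp (continuous_torusLift L)).measurable
  -- the influence functionals read on the torus
  have hYlm : ∀ i, Measurable fun V : GaugeConfig d L G => Y i (torusLift L V) := fun i =>
    (hYm i).comp (measurable_torusLift L)
  have hYlb : ∀ i (V : GaugeConfig d L G), |Y i (torusLift L V)| ≤ MY := fun i V => by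
    rw [abs_of_nonneg (hY0 i _)]; exact hYb i _
  have hYli : ∀ i, Integrable (fun V : GaugeConfig d L G => Y i (torusLift L V)) (wilsonMeasure ρ β) :=
    fun i => integrable_of_abs_le (hYlm i) (hYlb i)
  have hexpm : ∀ T : Finset (Fin n), Measurable fun V : GaugeConfig d L G =>
      Real.exp (∑ i ∈ T, Y i (torusLift L V)) := fun T => (Finset.measurable_sum T fun i _ => hYlm i).exp
  have hexpi : ∀ T : Finset (Fin n), Integrable (fun V : GaugeConfig d L G =>
      Real.exp (∑ i ∈ T, Y i (torusLift L V))) (wilsonMeasure ρ β) := fun T => by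
    refine integrable_of_abs_le (hexpm T) (C := Real.exp (∑ _i ∈ T, MY)) fun V => ?_
    rw [Real.abs_exp]
    exact Real.exp_le_exp.2 (Finset.sum_le_sum fun i _ => hYb i _)
  -- the mean influence is at most `e^B`
  have hEY : ∀ i, ∫ V, Y i (torusLift L V) ∂(wilsonMeasure ρ β) ≤ Real.exp B := by
    intro i
    have h1 : ∫ V, Y i (torusLift L V) ∂(wilsonMeasure ρ β) ≤
        ∫ V, Real.exp (∑ j ∈ ({i} : Finset (Fin n)), Y j (torusLift L V)) ∂(wilsonMeasure ρ β) := by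
      refine integral_mono (hYli i) (hexpi {i}) fun V => ?_
      simp only [Finset.sum_singleton]
      linarith [Real.add_one_le_exp (Y i (torusLift L V))]
    have h2 := hmom {i}
    rw [Finset.card_singleton, Nat.cast_one, mul_one] at h2
    exact h1.trans h2
  -- the degenerate case `n = 0`
  rcases Nat.eq_zero_or_pos n with hn | hn
  · subst hn
    simp
  -- the torus mean is the torus mean of the kernel mean (DLR step with trivial far factor)
  have hm' : ∀ i, m i = ∫ V, g i (torusLift L V) ∂(wilsonMeasure ρ β) := fun i => by
    have h1 := integral_torusLift_mul_eq_integral_ymSpecification_mul ρ hρ β (Λ i) (hAc i) (hAb i)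
      (hAS i) (hinj i) (H := fun _ => (1 : ℝ)) measurable_const (D := 1) (fun _ => by simp)
      (fun _ _ => rfl)
    rw [hm i]
    simpa [hgdef] using h1
  -- the torus means are within `ε (1 + e^B)` of `p`
  have hmp : ∀ i, |m i - p| ≤ ε * (1 + Real.exp B) := by
    intro i
    have e1 : m i - p = ∫ V, (g i (torusLift L V) - p) ∂(wilsonMeasure ρ β) := by
      rw [hm' i, integral_sub_const_of_abs_le (hgm i) (fun V => hgb i _) p]
    rw [e1]
    calc |∫ V, (g i (torusLift L V) - p) ∂(wilsonMeasure ρ β)|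
        ≤ ∫ V, |g i (torusLift L V) - p| ∂(wilsonMeasure ρ β) := abs_integral_le_integral_abs
      _ ≤ ∫ V, ε * (1 + Y i (torusLift L V)) ∂(wilsonMeasure ρ β) :=
          integral_mono_of_nonneg (ae_of_all _ fun V => abs_nonneg _)
            (((integrable_const (1 : ℝ)).add (hYli i)).const_mul ε) (ae_of_all _ fun V => hker i _)
      _ = ε * (1 + ∫ V, Y i (torusLift L V) ∂(wilsonMeasure ρ β)) := by
          rw [integral_const_mul, integral_add (integrable_const _) (hYli i), integral_const]
          simp
      _ ≤ ε * (1 + Real.exp B) := by gcongr; exact hEY i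
  -- pointwise bound on the collared factors
  set K : ℝ := ε * (2 + Real.exp B) with hKdef
  have hK : 0 ≤ K := by positivity
  have hh : ∀ i η, |g i η - m i| ≤ K * (1 + Y i η) := by
    intro i η
    have e1 : g i η - m i = (g i η - p) - (m i - p) := by ring
    rw [e1]
    have hY := hY0 i η
    have hB := Real.exp_nonneg B
    calc |(g i η - p) - (m i - p)| ≤ |g i η - p| + |m i - p| := abs_sub _ _
      _ ≤ ε * (1 + Y i η) + ε * (1 + Real.exp B) := add_le_add (hker i η) (hmp i)
      _ ≤ K * (1 + Y i η) := by
          rw [hKdef]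
          nlinarith [mul_nonneg hε hY, mul_nonneg (mul_nonneg hε hB) hY]
  -- the product of the collared factors is dominated by `K^n exp(Σ Yᵢ)`
  have hprod : ∀ V : GaugeConfig d L G, |∏ i, (g i (torusLift L V) - m i)| ≤
      K ^ n * Real.exp (∑ i, Y i (torusLift L V)) := by
    intro V
    rw [Finset.abs_prod]
    calc ∏ i, |g i (torusLift L V) - m i| ≤ ∏ i, K * (1 + Y i (torusLift L V)) :=
          Finset.prod_le_prod (fun i _ => abs_nonneg _) fun i _ => hh i _
      _ = K ^ n * ∏ i, (1 + Y i (torusLift L V)) := by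
          rw [Finset.prod_mul_distrib, Finset.prod_const, Finset.card_univ, Fintype.card_fin]
      _ ≤ K ^ n * ∏ i, Real.exp (Y i (torusLift L V)) := by
          refine mul_le_mul_of_nonneg_left ?_ (pow_nonneg hK _)
          refine Finset.prod_le_prod (fun i _ => by linarith [hY0 i (torusLift L V)]) fun i _ => ?_
          linarith [Real.add_one_le_exp (Y i (torusLift L V))]
      _ = K ^ n * Real.exp (∑ i, Y i (torusLift L V)) := by rw [Real.exp_sum]
  -- integrate
  have hmomU := hmom Finset.univ
  rw [Finset.card_univ, Fintype.card_fin] at hmomU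
  calc |∫ V, ∏ i, (g i (torusLift L V) - m i) ∂(wilsonMeasure ρ β)|
      ≤ ∫ V, |∏ i, (g i (torusLift L V) - m i)| ∂(wilsonMeasure ρ β) := abs_integral_le_integral_abs
    _ ≤ ∫ V, K ^ n * Real.exp (∑ i, Y i (torusLift L V)) ∂(wilsonMeasure ρ β) :=
        integral_mono_of_nonneg (ae_of_all _ fun V => abs_nonneg _) ((hexpi Finset.univ).const_mul _)
          (ae_of_all _ hprod)
    _ = K ^ n * ∫ V, Real.exp (∑ i, Y i (torusLift L V)) ∂(wilsonMeasure ρ β) := integral_const_mul _ _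
    _ ≤ K ^ n * Real.exp (B * n) := mul_le_mul_of_nonneg_left hmomU (pow_nonneg hK _)
    _ = (ε * ((2 + Real.exp B) * Real.exp B)) ^ n := by
        rw [mul_comm B, Real.exp_nat_mul, ← mul_pow, hKdef]; ring

end Engine

/-! ## §2 The registered odd-torus currency `MomentBounds6` from a tempered-response law and joint exponential moments -/

section Route

open Summit.QuantumFields.YangMills.Cruxes.OSLegsFromFemtoAndGap.DlrCollarTransfer
open Summit.QuantumFields.YangMills.Cruxes.UV.TorusClass

variable {G : Type} [Group G] [TopologicalSpace G] [IsTopologicalGroup G] [CompactSpace G]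
  [MeasurableSpace G] [BorelSpace G] (r : LatticeRep G) (a : ℝ → ℝ)

/-- **`MomentBounds6 G r a` from a TEMPERED-RESPONSE centre law and β-uniform joint exponential moments of the
influence — all odd sides, no rarity rate, no reflection positivity, no divisibility.**  Data: measurable influence
functionals `Y β R q x ≥ 0` of the exterior of the radius-`R+1` cube around `x` (bounded by `MY β R`), reference values
`|p q β| ≤ P₀`, constants `C₁ ≥ 0`, `B`, `ℓ₁ > 0`, `β₁`, with (a′) for `β ≥ β₁`, `1 ≤ R`, `R·a β ≤ ℓ₁`, every `q.1 < q.2`,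
`x` and EVERY exterior `η`: `|kerE(plane q x)(η) − p q β| ≤ (C₁/R⁴)(1 + Y β R q x η)`; (EM′) on every odd torus
`(ℤ/(2L+1))⁴`, `4R+8 ≤ L`, for cyclically `2R+4`-separated sites and every index set `T`,
`⟨exp(Σ_{i∈T} Y β R (q i) (x i)∘lift)⟩_{2L+1,β} ≤ exp(B·#T)`.  THEN `MomentBounds6 G r a` with `C = C₁ (2 + e^B) e^B`,
`β₄ = β₁`, `ℓ₄ = ℓ₁`.  Proof: §1 on the radius-`R+1` cubes (geometry of the landed collar). [folklore: Georgii (2011)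
Thm. 4.17 for the DLR part] -/
theorem momentBounds6_of_temperedResponse {C₁ B β₁ ℓ₁ P₀ : ℝ} {p : Fin 4 × Fin 4 → ℝ → ℝ}
    (Y : ℝ → ℕ → Fin 4 × Fin 4 → (Fin 4 → ℤ) → LGConfig 4 G → ℝ) (MY : ℝ → ℕ → ℝ)
    (hℓ₁ : 0 < ℓ₁) (hC₁ : 0 ≤ C₁) (hp : ∀ q β, |p q β| ≤ P₀)
    (hYm : ∀ β R q x, Measurable (Y β R q x)) (hY0 : ∀ β R q x η, 0 ≤ Y β R q x η)
    (hYb : ∀ β R q x η, Y β R q x η ≤ MY β R)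
    (hlaw : ∀ β : ℝ, β₁ ≤ β → ∀ R : ℕ, 1 ≤ R → (R : ℝ) * a β ≤ ℓ₁ →
      ∀ (q : Fin 4 × Fin 4) (x : Fin 4 → ℤ), q.1 < q.2 → ∀ η : LGConfig 4 G,
        |kerE G r β (fun k => x k - (R + 1)) (2 * R + 3) η (plane G r q x) - p q β| ≤
          C₁ / (R : ℝ) ^ 4 * (1 + Y β R q x η))
    (hEM : ∀ β : ℝ, β₁ ≤ β → ∀ (L n : ℕ) (q : Fin n → Fin 4 × Fin 4) (x : Fin n → (Fin 4 → ℤ)) (R : ℕ),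
      (∀ i, (q i).1 < (q i).2) → 1 ≤ R → (R : ℝ) * a β ≤ ℓ₁ → 4 * R + 8 ≤ L →
      (∀ i j : Fin n, i ≠ j → ∃ k : Fin 4,
        (2 * (R : ℤ) + 4) ≤ |((((x i k - x j k : ℤ) : ZMod (2 * L + 1))).valMinAbs : ℤ)|) →
      ∀ T : Finset (Fin n),
        torusE G r β L (fun U => Real.exp (∑ i ∈ T, Y β R (q i) (x i) U)) ≤ Real.exp (B * T.card)) :
    MomentBounds6 G r a := by
  haveI : SecondCountableTopology G :=
    (r.continuous.isClosedEmbedding r.injective).isEmbedding.secondCountableTopology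
  obtain ⟨CA, hCA⟩ := exists_abs_plane_le r
  have hP₀ : 0 ≤ P₀ := (abs_nonneg _).trans (hp (0, 1) 0)
  refine ⟨C₁ * ((2 + Real.exp B) * Real.exp B), β₁, ℓ₁, hℓ₁, by positivity, ?_⟩
  intro β hβ L n q x R hq hR hRa hRL hsep
  haveI := isProbabilityMeasure_wilsonMeasure (d := 4) (L := 2 * L + 1) r.ρ r.continuous β
  have hR0 : (0 : ℝ) < (R : ℝ) ^ 4 := by positivity
  have hmeas : ∀ i : Fin n, Measurable (plane G r (q i) (x i)) := fun i =>
    (continuous_plane r (q i) (x i)).measurable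
  have hAc : ∀ i : Fin n, Continuous fun U => plane G r (q i) (x i) U - p (q i) β := fun i =>
    (continuous_plane r (q i) (x i)).sub continuous_const
  have hAb : ∀ (i : Fin n) (U : LGConfig 4 G), |plane G r (q i) (x i) U - p (q i) β| ≤ CA + P₀ :=
    fun i U => (abs_sub _ _).trans (add_le_add (hCA _ _ _) (hp _ _))
  have hAS : ∀ i : Fin n, IsCylinder (fun U => plane G r (q i) (x i) U - p (q i) β)
      (cubeEdges (fun k => x i k - (R + 1)) (2 * R + 3)) :=
    fun i U V hUV => by simp only [isCylinder_plane_cube r hR (q i) (x i) hUV]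
  have hinj : ∀ i : Fin n, Set.InjOn (Torus.proj (2 * L + 1))
      (((cubeEdges (fun k => x i k - (R + 1)) (2 * R + 3) ∪ cubeEdges (fun k => x i k - (R + 1)) (2 * R + 3) ∪
          (plaquettesTouching (cubeEdges (fun k => x i k - (R + 1)) (2 * R + 3))).biUnion plaquetteEdges).image
          Prod.fst : Set (Fin 4 → ℤ))) := fun i => injOn_torusProj_cube hRL (x i)
  have hfar : ∀ i j : Fin n, i ≠ j → ∀ e ∈ cubeEdges (fun k => x j k - (R + 1)) (2 * R + 3) ∪
      (plaquettesTouching (cubeEdges (fun k => x j k - (R + 1)) (2 * R + 3))).biUnion plaquetteEdges,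
      ∀ e' ∈ cubeEdges (fun k => x i k - (R + 1)) (2 * R + 3),
      torusEdge (2 * L + 1) e ≠ torusEdge (2 * L + 1) e' :=
    fun i j hij e he e' he' => torusEdge_ne_cube (hsep i j hij) he he'
  have hm : ∀ i : Fin n, torusE G r β L (plane G r (q i) (x i)) - p (q i) β =
      ∫ W, (plane G r (q i) (x i) (torusLift (2 * L + 1) W) - p (q i) β)
        ∂(wilsonMeasure (d := 4) (L := 2 * L + 1) r.ρ β) := fun i =>
    (integral_sub_const_of_abs_le (μ := wilsonMeasure (d := 4) (L := 2 * L + 1) r.ρ β)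
      ((continuous_plane r (q i) (x i)).comp (continuous_torusLift (2 * L + 1))).measurable
      (fun W => hCA (q i) (x i) (torusLift (2 * L + 1) W)) (p (q i) β)).symm
  have hker : ∀ (i : Fin n) (η : LGConfig 4 G),
      |(∫ U, (plane G r (q i) (x i) U - p (q i) β) ∂(ymSpecification r.ρ β
        (cubeEdges (fun k => x i k - (R + 1)) (2 * R + 3)) η)) - 0| ≤
        C₁ / (R : ℝ) ^ 4 * (1 + Y β R (q i) (x i) η) := fun i η => by
    haveI := isProbabilityMeasure_ymSpecification r.ρ r.continuous β
      (cubeEdges (fun k => x i k - (R + 1)) (2 * R + 3)) η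
    rw [sub_zero, integral_sub_const_of_abs_le (hmeas i) (fun U => hCA (q i) (x i) U) (p (q i) β)]
    exact hlaw β hβ R hR hRa (q i) (x i) (hq i) η
  have hmom : ∀ T : Finset (Fin n),
      ∫ V, Real.exp (∑ i ∈ T, Y β R (q i) (x i) (torusLift (2 * L + 1) V))
        ∂(wilsonMeasure (d := 4) (L := 2 * L + 1) r.ρ β) ≤ Real.exp (B * T.card) :=
    fun T => hEM β hβ L n q x R hq hR hRa hRL hsep T
  have key := abs_integral_prod_sub_mean_le_of_response (d := 4) r.ρ r.continuous β (L := 2 * L + 1) (n := n)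
      (fun i => cubeEdges (fun k => x i k - (R + 1)) (2 * R + 3))
      (fun i => cubeEdges (fun k => x i k - (R + 1)) (2 * R + 3))
      (fun i U => plane G r (q i) (x i) U - p (q i) β) hAc hAb hAS hinj hfar
      (fun i => torusE G r β L (plane G r (q i) (x i)) - p (q i) β) hm
      (fun i => Y β R (q i) (x i)) (fun i => hYm β R (q i) (x i)) (fun i η => hY0 β R (q i) (x i) η)
      (MY := MY β R) (fun i η => hYb β R (q i) (x i) η)
      (p := 0) (ε := C₁ / (R : ℝ) ^ 4) (B := B) (by positivity) hker hmom
  simp only [sub_sub_sub_cancel_right] at key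
  refine key.trans (le_of_eq ?_)
  congr 1
  field_simp

/-! ## §3 The class currency `MomentBounds6OnSides 𝓣` likewise (lane A's station) -/

/-- **`MomentBounds6OnSides G r a 𝓣` from a tempered-response centre law and β-uniform joint exponential moments on the
tori of the class** — the twin of `momentBounds6_of_temperedResponse` for the class-parametric ceilings (p464599; half-side
clause `8R+16 ≤ M`), same constant `C₁ (2 + e^B) e^B`.  For Track A's even class the block-chessboard route (p522661) may
supply (EM′) through exponential CHEBYSHEV-free moment bounds; no rarity rate is needed. [folklore: Georgii (2011)
Thm. 4.17 for the DLR part] -/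
theorem momentBounds6OnSides_of_temperedResponse (𝓣 : Set ℕ) {C₁ B β₁ ℓ₁ P₀ : ℝ} {p : Fin 4 × Fin 4 → ℝ → ℝ}
    (Y : ℝ → ℕ → Fin 4 × Fin 4 → (Fin 4 → ℤ) → LGConfig 4 G → ℝ) (MY : ℝ → ℕ → ℝ)
    (hℓ₁ : 0 < ℓ₁) (hC₁ : 0 ≤ C₁) (hp : ∀ q β, |p q β| ≤ P₀)
    (hYm : ∀ β R q x, Measurable (Y β R q x)) (hY0 : ∀ β R q x η, 0 ≤ Y β R q x η)
    (hYb : ∀ β R q x η, Y β R q x η ≤ MY β R)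
    (hlaw : ∀ β : ℝ, β₁ ≤ β → ∀ R : ℕ, 1 ≤ R → (R : ℝ) * a β ≤ ℓ₁ →
      ∀ (q : Fin 4 × Fin 4) (x : Fin 4 → ℤ), q.1 < q.2 → ∀ η : LGConfig 4 G,
        |kerE G r β (fun k => x k - (R + 1)) (2 * R + 3) η (plane G r q x) - p q β| ≤
          C₁ / (R : ℝ) ^ 4 * (1 + Y β R q x η))
    (hEM : ∀ β : ℝ, β₁ ≤ β → ∀ (M : ℕ) [NeZero M], M ∈ 𝓣 →
      ∀ (n : ℕ) (q : Fin n → Fin 4 × Fin 4) (x : Fin n → (Fin 4 → ℤ)) (R : ℕ),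
      (∀ i, (q i).1 < (q i).2) → 1 ≤ R → (R : ℝ) * a β ≤ ℓ₁ → 8 * R + 16 ≤ M →
      (∀ i j : Fin n, i ≠ j → ∃ k : Fin 4,
        (2 * (R : ℤ) + 4) ≤ |((((x i k - x j k : ℤ) : ZMod M)).valMinAbs : ℤ)|) →
      ∀ T : Finset (Fin n),
        torusEOn G r β M (fun U => Real.exp (∑ i ∈ T, Y β R (q i) (x i) U)) ≤ Real.exp (B * T.card)) :
    MomentBounds6OnSides G r a 𝓣 := by
  haveI : SecondCountableTopology G :=
    (r.continuous.isClosedEmbedding r.injective).isEmbedding.secondCountableTopology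
  obtain ⟨CA, hCA⟩ := exists_abs_plane_le r
  have hP₀ : 0 ≤ P₀ := (abs_nonneg _).trans (hp (0, 1) 0)
  refine ⟨C₁ * ((2 + Real.exp B) * Real.exp B), β₁, ℓ₁, hℓ₁, by positivity, ?_⟩
  intro β hβ M _ hM n q x R hq hR hRa hRM hsep
  haveI := isProbabilityMeasure_wilsonMeasure (d := 4) (L := M) r.ρ r.continuous β
  have hR0 : (0 : ℝ) < (R : ℝ) ^ 4 := by positivity
  have hmeas : ∀ i : Fin n, Measurable (plane G r (q i) (x i)) := fun i =>
    (continuous_plane r (q i) (x i)).measurable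
  have hAc : ∀ i : Fin n, Continuous fun U => plane G r (q i) (x i) U - p (q i) β := fun i =>
    (continuous_plane r (q i) (x i)).sub continuous_const
  have hAb : ∀ (i : Fin n) (U : LGConfig 4 G), |plane G r (q i) (x i) U - p (q i) β| ≤ CA + P₀ :=
    fun i U => (abs_sub _ _).trans (add_le_add (hCA _ _ _) (hp _ _))
  have hAS : ∀ i : Fin n, IsCylinder (fun U => plane G r (q i) (x i) U - p (q i) β)
      (cubeEdges (fun k => x i k - (R + 1)) (2 * R + 3)) :=
    fun i U V hUV => by simp only [isCylinder_plane_cube r hR (q i) (x i) hUV]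
  have hinj : ∀ i : Fin n, Set.InjOn (Torus.proj M)
      (((cubeEdges (fun k => x i k - (R + 1)) (2 * R + 3) ∪ cubeEdges (fun k => x i k - (R + 1)) (2 * R + 3) ∪
          (plaquettesTouching (cubeEdges (fun k => x i k - (R + 1)) (2 * R + 3))).biUnion plaquetteEdges).image
          Prod.fst : Set (Fin 4 → ℤ))) := fun i => injOn_torusProj_cube_side hRM (x i)
  have hfar : ∀ i j : Fin n, i ≠ j → ∀ e ∈ cubeEdges (fun k => x j k - (R + 1)) (2 * R + 3) ∪
      (plaquettesTouching (cubeEdges (fun k => x j k - (R + 1)) (2 * R + 3))).biUnion plaquetteEdges,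
      ∀ e' ∈ cubeEdges (fun k => x i k - (R + 1)) (2 * R + 3),
      torusEdge M e ≠ torusEdge M e' :=
    fun i j hij e he e' he' => torusEdge_ne_cube_side (hsep i j hij) he he'
  have hm : ∀ i : Fin n, torusEOn G r β M (plane G r (q i) (x i)) - p (q i) β =
      ∫ W, (plane G r (q i) (x i) (torusLift M W) - p (q i) β)
        ∂(wilsonMeasure (d := 4) (L := M) r.ρ β) := fun i =>
    (integral_sub_const_of_abs_le (μ := wilsonMeasure (d := 4) (L := M) r.ρ β)
      ((continuous_plane r (q i) (x i)).comp (continuous_torusLift M)).measurable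
      (fun W => hCA (q i) (x i) (torusLift M W)) (p (q i) β)).symm
  have hker : ∀ (i : Fin n) (η : LGConfig 4 G),
      |(∫ U, (plane G r (q i) (x i) U - p (q i) β) ∂(ymSpecification r.ρ β
        (cubeEdges (fun k => x i k - (R + 1)) (2 * R + 3)) η)) - 0| ≤
        C₁ / (R : ℝ) ^ 4 * (1 + Y β R (q i) (x i) η) := fun i η => by
    haveI := isProbabilityMeasure_ymSpecification r.ρ r.continuous β
      (cubeEdges (fun k => x i k - (R + 1)) (2 * R + 3)) η
    rw [sub_zero, integral_sub_const_of_abs_le (hmeas i) (fun U => hCA (q i) (x i) U) (p (q i) β)]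
    exact hlaw β hβ R hR hRa (q i) (x i) (hq i) η
  have hmom : ∀ T : Finset (Fin n),
      ∫ V, Real.exp (∑ i ∈ T, Y β R (q i) (x i) (torusLift M V))
        ∂(wilsonMeasure (d := 4) (L := M) r.ρ β) ≤ Real.exp (B * T.card) :=
    fun T => hEM β hβ M hM n q x R hq hR hRa hRM hsep T
  have key := abs_integral_prod_sub_mean_le_of_response (d := 4) r.ρ r.continuous β (L := M) (n := n)
      (fun i => cubeEdges (fun k => x i k - (R + 1)) (2 * R + 3))
      (fun i => cubeEdges (fun k => x i k - (R + 1)) (2 * R + 3))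
      (fun i U => plane G r (q i) (x i) U - p (q i) β) hAc hAb hAS hinj hfar
      (fun i => torusEOn G r β M (plane G r (q i) (x i)) - p (q i) β) hm
      (fun i => Y β R (q i) (x i)) (fun i => hYm β R (q i) (x i)) (fun i η => hY0 β R (q i) (x i) η)
      (MY := MY β R) (fun i η => hYb β R (q i) (x i) η)
      (p := 0) (ε := C₁ / (R : ℝ) ^ 4) (B := B) (by positivity) hker hmom
  simp only [sub_sub_sub_cancel_right] at key
  refine key.trans (le_of_eq ?_)
  congr 1
  field_simp

end Route

end Summit.QuantumFields.YangMills.Cruxes.UVSeamRec.TemperedResponse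

end
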